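import Summits.ResolutionOfSingularities.ResolutionOfSingularities.Theorems.RadicialJungCleanModelsLocalMonomializationAlongCoarsening
import Literature.AlgebraicGeometry.Resolution.RankOneReductionProofs
import HarnessLib

/-!
# Rescaling the r.s.p. of the coarse local ring into the model, with monomial coefficients IN THE MODEL (step (i) ⟶ step (iii) hand-over)

Route `RadicialJung`, crux `CleanModels` (stmt-ResolutionOfSingularities-15917), registered skeleton `Cruxes/CleanModels/Lines/Sketch.lean`
rev 35 (sha16 de44649d8f729c3b), stub 7 `stub_cleanModelsDimGEFour`.  Explicit-unit seat `decomp-res-hand-2` g5 (structural hand); memo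
`Cruxes/CleanModels/Lines/Sketch-memo-hand2-g5-stubs-5-7.md` §2.  OURS; structural bookkeeping, counted 0; nothing here proves resolution of
singularities in characteristic `p`.

Step (i) of the repaired Novacoski–Spivakovsky combination (✓ `weakEmbeddedLU_along_properCoarsening_dimLEFour`) monomialises `Z` in the
local ring `R₁ = locAtCentre A O₁` at the centre of the COARSE valuation: `z = v_z · ∏ a_i^{μ_i}` with `a_i` generating `𝔪_{R₁}` and `v_z ∈ R₁ˣ`.
The later bricks (✓ `blowupAlong_rsp_of_centre`, ✓ `absorption_step`) want the generators IN THE MODEL and the coefficients IN THE MODEL: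
`z = c_z · ∏ y_i^{μ_i}` with `y_i, c_z ∈ A₃`, `ν₁(c_z) = 0`.  Since `c_z = z / y^{μ}` is a priori only in `R₁`, one RESCALES: with `D ∈ A` the
product of all denominators (a `ν₁`-unit), `y_i := n_i / D²` (`a_i = n_i / e_i`) lies in `𝔪_{O₁} ⊆ O`, differs from `a_i` by a unit of `R₁`, and
`c_z = p_z · D^{2|μ|} / (q_z ∏ e_i^{μ_i}) ∈ A` because `q_z ∏ e_i^{μ_i}` divides `D^{1+|μ|}` (exact clearing; for `μ_z = 0`, `c_z = z`).

* `exists_rsp_in_model_of_monomial` — the statement, with the unit comparison `y_i = a_i · u_i` (`u_i ∈ R₁ˣ`) and `locAtCentre A₃ O₁ = R₁`.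
[cite: NovacoskiSpivakovsky2014, §3.2 (21)–(22)]
-/

noncomputable section

set_option linter.dupNamespace false -- mandated namespace of this single-conjunct summit

open IsLocalRing
open Literature.AlgebraicGeometry.Resolution

namespace Summit.ResolutionOfSingularities.ResolutionOfSingularities.Theorems.RadicialJung.CleanModels

variable {k K : Type} [Field k] [Field K] [Algebra k K]

/-- **Rescaling into the model.** Let `O ≤ O₁`, `A ⊆ O` a finitely generated model, `R₁ = locAtCentre A O₁`, `a_i ∈ 𝔪_{R₁}` (`i < r`) and
`Z ⊆ A` finite with `z = v_z · ∏ a_i^{μ_{z,i}}`, `v_z ∈ R₁ˣ`.  Then there is a finitely generated model `A ⊆ A₃ ⊆ O` with `locAtCentre A₃ O₁ = R₁`,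
elements `y_i ∈ A₃` of positive `ν₁`-value with `y_i = a_i · u_i` for units `u_i` of `R₁`, and coefficients `c_z ∈ A₃` with `ν₁(c_z) = 0` and
`z = c_z · ∏ y_i^{μ_{z,i}}` for every `z ∈ Z`. [cite: NovacoskiSpivakovsky2014, §3.2 (21)–(22)] -/
theorem exists_rsp_in_model_of_monomial (O O₁ : ValuationSubring K) (hO : O ≤ O₁)
    (A : Subalgebra k K) (hA : A.toSubring ≤ O.toSubring) (hAfg : A.FG)
    {r : ℕ} (a : Fin r → locAtCentre A.toSubring O₁) (ha𝔪 : ∀ i, O₁.valuation ((a i : K)) < 1)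
    (Z : Finset K) (hZA : ∀ z ∈ Z, z ∈ A) (v : K → locAtCentre A.toSubring O₁) (μ : K → Fin r → ℕ)
    (hv : ∀ z ∈ Z, IsUnit (v z))
    (hz : ∀ z ∈ Z, z = (v z : K) * ∏ i, ((a i : K)) ^ (μ z i)) :
    ∃ (A₃ : Subalgebra k K) (_ : A₃.toSubring ≤ O.toSubring), A ≤ A₃ ∧ A₃.FG ∧
      locAtCentre A₃.toSubring O₁ = locAtCentre A.toSubring O₁ ∧
      ∃ (y : Fin r → A₃.toSubring) (u : Fin r → locAtCentre A.toSubring O₁),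
        (∀ i, IsUnit (u i) ∧ ((y i : K)) = (a i : K) * (u i : K)) ∧
        (∀ i, O₁.valuation ((y i : K)) < 1) ∧
        ∃ c : K → A₃.toSubring, ∀ z ∈ Z, O₁.valuation ((c z : K)) = 1 ∧ z = (c z : K) * ∏ i, ((y i : K)) ^ (μ z i) := by
  classical
  have hAO₁ : A.toSubring ≤ O₁.toSubring := hA.trans hO
  have hR₁O₁ : locAtCentre A.toSubring O₁ ≤ O₁.toSubring := locAtCentre_le hAO₁
  haveI : IsLocalRing (locAtCentre A.toSubring O₁) := isLocalRing_locAtCentre hAO₁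
  have hunitval : ∀ x : (locAtCentre A.toSubring O₁), IsUnit x → O₁.valuation (x : K) = 1 := by
    intro x hx
    have h1 : ¬ O₁.valuation (x : K) < 1 := fun h => ((not_isUnit_locAtCentre_iff hAO₁ x).mpr h) hx
    exact le_antisymm ((O₁.valuation_le_one_iff _).mpr (hR₁O₁ x.2)) (not_lt.mp h1)
  have hvalunit : ∀ x : (locAtCentre A.toSubring O₁), O₁.valuation (x : K) = 1 → IsUnit x := by
    intro x hx
    by_contra h
    have := (not_isUnit_locAtCentre_iff hAO₁ x).mp h
    rw [hx] at this; exact lt_irrefl _ this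
  -- numerators and denominators
  have hfrac : ∀ x : (locAtCentre A.toSubring O₁), ∃ n e : K, n ∈ A ∧ e ∈ A ∧ O₁.valuation e = 1 ∧ (x : K) = n / e := by
    intro x
    obtain ⟨n, hn, e, he, he1, hx⟩ := (mem_locAtCentre_iff).mp x.2
    exact ⟨n, e, hn, he, he1, hx⟩
  choose nm dn hnmA hdnA hdn1 hnd using hfrac
  have hdn0 : ∀ x : (locAtCentre A.toSubring O₁), dn x ≠ 0 := fun x => ne_zero_of_valuation_eq_one (hdn1 x)
  -- the common denominator `D`
  set D : K := (∏ i, dn (a i)) * ∏ z ∈ Z, dn (v z) with hDdef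
  have hDA : D ∈ A := A.mul_mem (A.prod_mem fun i _ => hdnA _) (A.prod_mem fun z _ => hdnA _)
  have hD1 : O₁.valuation D = 1 := by
    rw [hDdef, map_mul, map_prod, map_prod, Finset.prod_eq_one fun i _ => hdn1 _, Finset.prod_eq_one fun z _ => hdn1 _, one_mul]
  have hD0 : D ≠ 0 := ne_zero_of_valuation_eq_one hD1
  -- the rescaled parameters `y_i = n_i / D²`
  let yK : Fin r → K := fun i => nm (a i) / D ^ 2
  have hyval : ∀ i, O₁.valuation (yK i) < 1 := by
    intro i
    have : O₁.valuation (yK i) = O₁.valuation ((a i : K)) := by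
      simp only [yK]
      rw [map_div₀, map_pow, hD1, one_pow, div_one, hnd (a i), map_div₀, hdn1, div_one]
    rw [this]; exact ha𝔪 i
  have hyO : ∀ i, yK i ∈ O := fun i =>
    mem_of_mem_maximalIdeal_of_le O O₁ hO ⟨yK i, (O₁.valuation_le_one_iff _).mp (hyval i).le⟩
      (by rw [ValuationSubring.valuation_lt_one_iff]; exact hyval i)
  have hyR₁ : ∀ i, yK i ∈ (locAtCentre A.toSubring O₁) := fun i =>
    (mem_locAtCentre_iff).mpr ⟨nm (a i), hnmA _, D ^ 2, A.pow_mem hDA 2, by rw [map_pow, hD1, one_pow], rfl⟩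
  -- the model `A₃ = A[y]`
  let A₃ : Subalgebra k K := A ⊔ Algebra.adjoin k ((Finset.univ.image yK : Finset K) : Set K)
  have hAA₃ : A ≤ A₃ := le_sup_left
  have hyA₃ : ∀ i, yK i ∈ A₃ := fun i =>
    (le_sup_right : Algebra.adjoin k _ ≤ A₃) (Algebra.subset_adjoin (by simp))
  have hk : ∀ c : k, algebraMap k K c ∈ O := fun c => hA (A.algebraMap_mem c)
  have hA₃O : A₃.toSubring ≤ O.toSubring := by
    have : A₃ ≤ ({ O.toSubring with algebraMap_mem' := hk } : Subalgebra k K) := by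
      refine sup_le (fun x hx => hA hx) (Algebra.adjoin_le ?_)
      intro x hx
      rw [Finset.coe_image] at hx
      obtain ⟨i, -, rfl⟩ := hx
      exact hyO i
    exact fun x hx => this hx
  have hA₃fg : A₃.FG := hAfg.sup ⟨_, rfl⟩
  have hα : locAtCentre A₃.toSubring O₁ = (locAtCentre A.toSubring O₁) := by
    refine locAtCentre_eq_of_mutual_le O₁ A₃.toSubring A.toSubring ?_ (fun x hx => le_locAtCentre _ _ (hAA₃ hx))
    let R₁' : Subalgebra k K :=
      ({ locAtCentre A.toSubring O₁ with algebraMap_mem' := fun c => le_locAtCentre A.toSubring O₁ (A.algebraMap_mem c) } : Subalgebra k K)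
    have : A₃ ≤ R₁' := by
      refine sup_le (fun x hx => le_locAtCentre A.toSubring O₁ hx) (Algebra.adjoin_le ?_)
      intro x hx
      rw [Finset.coe_image] at hx
      obtain ⟨i, -, rfl⟩ := hx
      exact hyR₁ i
    exact fun x hx => this hx
  -- the units `u_i = e_i / D²`
  have huR₁ : ∀ i, dn (a i) / D ^ 2 ∈ (locAtCentre A.toSubring O₁) := fun i =>
    (mem_locAtCentre_iff).mpr ⟨dn (a i), hdnA _, D ^ 2, A.pow_mem hDA 2, by rw [map_pow, hD1, one_pow], rfl⟩
  let u : Fin r → (locAtCentre A.toSubring O₁) := fun i => ⟨dn (a i) / D ^ 2, huR₁ i⟩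
  have hu : ∀ i, IsUnit (u i) ∧ yK i = (a i : K) * (u i : K) := by
    intro i
    refine ⟨hvalunit _ (by change O₁.valuation (dn (a i) / D ^ 2) = 1; rw [map_div₀, map_pow, hD1, hdn1, one_pow, div_one]), ?_⟩
    change nm (a i) / D ^ 2 = (a i : K) * (dn (a i) / D ^ 2)
    rw [hnd (a i)]
    field_simp [hdn0 (a i)]
  -- the coefficients
  have hcoef : ∀ z ∈ Z, ∃ c : K, c ∈ A ∧ O₁.valuation c = 1 ∧ z = c * ∏ i, (yK i) ^ (μ z i) := by
    intro z hzZ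
    set N : ℕ := ∑ i, μ z i with hNdef
    have hvz1 : O₁.valuation ((v z : K)) = 1 := hunitval _ (hv z hzZ)
    have hpz1 : O₁.valuation (nm (v z)) = 1 := by
      have := hvz1; rw [hnd (v z), map_div₀, hdn1, div_one] at this; exact this
    by_cases hN : N = 0
    · -- `μ_z = 0`: `c_z = z`
      have hμ0 : ∀ i, μ z i = 0 := fun i => by
        have := Finset.sum_eq_zero_iff.mp (hNdef ▸ hN : ∑ i, μ z i = 0) i (Finset.mem_univ i); exact this
      have hz' : z = (v z : K) := by
        conv_lhs => rw [hz z hzZ]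
        simp [hμ0]
      refine ⟨z, hZA z hzZ, by rw [hz']; exact hvz1, ?_⟩
      simp [hμ0]
    · -- `|μ_z| ≥ 1`: exact clearing through `q_z ∏ e_i^{μ_i} ∣ D^{1 + |μ|} ∣ D^{2|μ|}`
      have hN1 : 1 ≤ N := Nat.one_le_iff_ne_zero.mpr hN
      let q : A.toSubring := ⟨dn (v z), hdnA _⟩
      let e : Fin r → A.toSubring := fun i => ⟨dn (a i), hdnA _⟩
      let DA : A.toSubring := ⟨D, hDA⟩
      have hqD : q ∣ DA := by
        refine ⟨⟨(∏ i, dn (a i)) * ∏ z' ∈ Z.erase z, dn (v z'), A.mul_mem (A.prod_mem fun i _ => hdnA _)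
          (A.prod_mem fun z' _ => hdnA _)⟩, Subtype.ext ?_⟩
        change D = dn (v z) * ((∏ i, dn (a i)) * ∏ z' ∈ Z.erase z, dn (v z'))
        rw [hDdef, ← Finset.mul_prod_erase Z (fun z' => dn (v z')) hzZ]; ring
      have heD : ∀ i, e i ∣ DA := by
        intro i
        refine ⟨⟨(∏ j ∈ Finset.univ.erase i, dn (a j)) * ∏ z' ∈ Z, dn (v z'), A.mul_mem (A.prod_mem fun j _ => hdnA _)
          (A.prod_mem fun z' _ => hdnA _)⟩, Subtype.ext ?_⟩
        change D = dn (a i) * ((∏ j ∈ Finset.univ.erase i, dn (a j)) * ∏ z' ∈ Z, dn (v z'))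
        rw [hDdef, ← Finset.mul_prod_erase Finset.univ (fun j => dn (a j)) (Finset.mem_univ i)]; ring
      have hdiv : q * ∏ i, e i ^ μ z i ∣ DA ^ (2 * N) := by
        have h1 : ∏ i, e i ^ μ z i ∣ DA ^ N := by
          rw [hNdef, ← Finset.prod_pow_eq_pow_sum]
          exact Finset.prod_dvd_prod_of_dvd _ _ fun i _ => pow_dvd_pow_of_dvd (heD i) _
        have h2 : q * ∏ i, e i ^ μ z i ∣ DA ^ (1 + N) := by
          rw [pow_add, pow_one]; exact mul_dvd_mul hqD h1
        exact h2.trans (pow_dvd_pow _ (by omega))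
      obtain ⟨t, ht⟩ := hdiv
      have htK : D ^ (2 * N) = dn (v z) * (∏ i, dn (a i) ^ μ z i) * (t : K) := by
        have := congrArg (fun x : A.toSubring => (x : K)) ht
        push_cast at this
        exact this
      have ht1 : O₁.valuation (t : K) = 1 := by
        have h := congrArg (fun x => O₁.valuation x) htK
        simp only [map_pow, map_mul, map_prod, hD1, one_pow, hdn1, one_mul, Finset.prod_const_one] at h
        exact h.symm
      have ht0 : (t : K) ≠ 0 := ne_zero_of_valuation_eq_one ht1
      refine ⟨nm (v z) * (t : K), A.mul_mem (hnmA _) t.2, by rw [map_mul, hpz1, ht1, one_mul], ?_⟩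
      -- the identity in `K`
      have hyprod : ∏ i, (yK i) ^ (μ z i) = (∏ i, (nm (a i)) ^ (μ z i)) / D ^ (2 * N) := by
        simp only [yK, div_pow]
        rw [Finset.prod_div_distrib, Finset.prod_pow_eq_pow_sum, ← pow_mul, hNdef]
      have haprod : ∏ i, ((a i : K)) ^ (μ z i) = (∏ i, (nm (a i)) ^ (μ z i)) / ∏ i, (dn (a i)) ^ (μ z i) := by
        rw [← Finset.prod_div_distrib]
        refine Finset.prod_congr rfl fun i _ => ?_
        rw [hnd (a i), div_pow]
      have he0 : ∏ i, (dn (a i)) ^ (μ z i) ≠ 0 := Finset.prod_ne_zero_iff.mpr fun i _ => pow_ne_zero _ (hdn0 _)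
      rw [hyprod, htK]
      conv_lhs => rw [hz z hzZ, haprod, hnd (v z)]
      field_simp
  choose c hcA hc1 hcz using hcoef
  refine ⟨A₃, hA₃O, hAA₃, hA₃fg, hα, fun i => ⟨yK i, hyA₃ i⟩, u, hu, hyval,
    fun z => if hzZ : z ∈ Z then ⟨c z hzZ, hAA₃ (hcA z hzZ)⟩ else 1, ?_⟩
  intro z hzZ
  simp only [dif_pos hzZ]
  exact ⟨hc1 z hzZ, hcz z hzZ⟩

end Summit.ResolutionOfSingularities.ResolutionOfSingularities.Theorems.RadicialJung.CleanModels

end
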